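import Summits.HodgeConjecture.HodgeCM.Model.Inhabited   -- ★ `HodgeCM.cyclo7 = ⟨CyclotomicField 7 ℚ⟩`, `cyclo7_isGalois`, `cyclo7_finrank`, `stdCMType`
import Summits.HodgeConjecture.HodgeCM.Proofs.Landherr   -- ★ `HodgeCM.landherr_exists_proof : ∀ L ι₁, Nonempty (HodgeCM.HermSpace3 L ι₁)` (Landherr 1936, existence direction)
import Summits.HodgeConjecture.HodgeCM.Model.LiuIndexPin   -- ★ `HodgeCM.Model.LiuIndex.RealScalar`
import Summits.HodgeConjecture.CorCM.B01.Transposition.HComp.ComplexRecordSystemOfPieces   -- ★ `CorCM.HComp.nonempty_complexRecordSystem_K3`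
import Literature.NumberTheory.Automorphic.Liu2021.LemD1AsPrintedIndexedNonVacuityNonsplitPlace   -- ★ `exists_isConjugateSymplectic_hasWeight_one`
import HarnessLib

/-!
# Non-vacuity of the GALOIS parameter datum of the remaining printed-citation binders (`ℚ(ζ₇)`)

Cell `hodgecm-mathlib`, director g15 s459 ROW «NONVAC-II (GALOIS DATUM)» (sequel of ★ p810343
`Theorems/HCCMNonvacuityHermSpace3K2.lean`, ROW «NONVAC-V₂»: the NON-Galois sextic datum `K₂`).  HONEST LABEL: HC_CM is proved only modulo
the 7 printed citations until rung 0 closes; this file proves NOTHING about Hodge classes.  It records, from ★ theorems of the tree alone and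
with no hypothesis, that the ∀-telescopes of the two REMAINING binders `hLiu418` (item stmt-HodgeConjecture-24832) and `h413`
(stmt-HodgeConjecture-24833) of `hc_cm_of_printed_citations_muKey_ident_lemD3_delRecConjOmegaT` — and of the discharged `h411` ∕ `hD3` ∕ `hD1''`
(`CorCM/D2Bridge/PrintedCitationHypothesesT.lean` :59–:110) —

  `∀ (F : HodgeCM.CMField) [IsGalois ℚ F] (h6 : 6 ≤ Module.finrank ℚ F) {ι₁ : F →+* ℂ} (V : HodgeCM.HermSpace3 F ι₁) (a : RealScalar F)`
  `  (Φ : CMType F) (hΦ : ι₁ ∈ Φ.1) (ν : IdeleClassGroup F →ₜ* Circle) (hν : IsConjugateSymplectic F ν) (hw : HasWeight F ν 1) …`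

range over an INHABITED parameter domain, with a kernel witness at the GALOIS sextic CM field `ℚ(ζ₇)`:

* `exists_galois_cmField_hermSpace3` — `F := HodgeCM.cyclo7 = ⟨CyclotomicField 7 ℚ⟩` (★ `HodgeCM/Model/Inhabited.lean`: CM by
  `IsCyclotomicExtension.Rat.isCMField`, Galois by `IsCyclotomicExtension.isGalois`, `[F:ℚ] = φ(7) = 6`), `ι₁ :=` the distinguished
  embedding of an infinite place, and `V : HodgeCM.HermSpace3 F ι₁` by ★ LANDHERR'S EXISTENCE THEOREM `HodgeCM.landherr_exists_proof`
  (`HodgeCM/Proofs/Landherr.lean`: over EVERY CM field and EVERY `ι₁` there is a hermitian 3-space of signature `(2,1)` at `ι₁` and `(3,0)`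
  elsewhere — `diag(1, 1, 1 − u ū)` for a Dirichlet unit `u`, Mathlib `NumberField.Units.dirichletUnitTheorem.exists_unit`).
* `exists_galois_binder_prefix` — the same datum extended by `a : RealScalar F := 1`, the standard CM type `Φ := HodgeCM.stdCMType F ∋ ι₁`, and a
  conjugate-symplectic weight-one character `ν` (★ `Liu2021.LemD1IndexedNonVacuityNonsplitPlace.exists_isConjugateSymplectic_hasWeight_one`,
  [Liu2021] Def. 4.1 ∕ 4.3): the COMPLETE ∀-telescope of `Hyp411` after `hDel`, and the common prefix of `HypLiu418` ∕ `Hyp413` ∕ `HypD3` ∕ `HypD1pp`.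
* `exists_galois_complexRecordSystem` — at that datum the `h`-free complex record system of `Sh(U(V), 𝔹²)` below Liu's `K_f(3)` is inhabited
  (★ `CorCM.HComp.nonempty_complexRecordSystem_K3` through the one-token HodgeCM→CorCM bridge `⟨V.Hm, V.isHermitian, V.signature_ι₁, V.posDef_of_ne⟩`,
  the very spelling of the binder texts; [Deligne1979ShimuraVarieties] 2.1.2–2.1.4, [Liu2021] App. C).

0 `def`, 0 `instance`, 0 `notation`, 0 `axiom`, 0 `sorry`; theorems only; imports Summits ∕ Literature ∕ HarnessLib.  Filed
`--kind proof --supports stmt-HodgeConjecture-24832 --as helper` (helper file; no skeleton registration).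
-/

set_option autoImplicit false

noncomputable section

open NumberField NumberField.InfinitePlace
open Literature.AlgebraicGeometry.Motives (CMType)
open Literature.NumberTheory.Automorphic.IdeleClassGroup (IsConjugateSymplectic HasWeight)

namespace Summit.HodgeConjecture.HodgeConjecture.Theorems.HCCMNonvacuityGaloisDatumCyc7

set_option linter.dupNamespace false in
/-- `6 ≤ [ℚ(ζ₇):ℚ]` (`= 6`, ★ `HodgeCM.cyclo7_finrank`) — the degree binder `h6` of the printed-citation rows. [folklore] -/
theorem six_le_finrank_cyclo7 : 6 ≤ Module.finrank ℚ HodgeCM.cyclo7 := HodgeCM.cyclo7_finrank.ge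

set_option linter.dupNamespace false in
/-- Over `ℚ(ζ₇)` and ANY embedding `ι₁` there is a hermitian 3-space of signature `(2,1)` at `ι₁`, definite elsewhere — Landherr's existence
theorem, ★ `HodgeCM.landherr_exists_proof`, specialised. [folklore] -/
theorem nonempty_hermSpace3_cyclo7 (ι₁ : HodgeCM.cyclo7 →+* ℂ) : Nonempty (HodgeCM.HermSpace3 HodgeCM.cyclo7 ι₁) :=
  HodgeCM.landherr_exists_proof HodgeCM.cyclo7 ι₁

set_option linter.dupNamespace false in
/-- **The Galois parameter datum `(F, [IsGalois ℚ F], 6 ≤ [F:ℚ], ι₁, V : HodgeCM.HermSpace3 F ι₁)` of the remaining printed-citation binders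
`hLiu418` ∕ `h413` (and of `h411` ∕ `hD3` ∕ `hD1''`) is INHABITED** — at `F = ℚ(ζ₇)` (★ `HodgeCM.cyclo7`), `ι₁` the embedding of an infinite
place, `V` by Landherr (★ `HodgeCM.landherr_exists_proof`).  Hypothesis-free. [folklore] -/
theorem exists_galois_cmField_hermSpace3 :
    ∃ (F : HodgeCM.CMField) (_ : IsGalois ℚ F) (_ : 6 ≤ Module.finrank ℚ F) (ι₁ : F →+* ℂ), Nonempty (HodgeCM.HermSpace3 F ι₁) := by
  obtain ⟨w⟩ := (inferInstance : Nonempty (InfinitePlace HodgeCM.cyclo7))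
  exact ⟨HodgeCM.cyclo7, HodgeCM.cyclo7_isGalois, six_le_finrank_cyclo7, w.embedding, nonempty_hermSpace3_cyclo7 w.embedding⟩

set_option linter.dupNamespace false in
/-- The distinguished embedding of an infinite place lies in the standard CM type (★ `HodgeCM.stdCMType`: one embedding per place) — the
binder `hΦ : ι₁ ∈ Φ.1`. [folklore] -/
theorem embedding_mem_stdCMType (F : HodgeCM.CMField) (w : InfinitePlace F) : w.embedding ∈ (HodgeCM.stdCMType F).1 :=
  ⟨w, rfl⟩

set_option linter.dupNamespace false in
/-- `1` as a Gram scalar of a hermitian line: a `RealScalar` (non-zero, fixed by complex conjugation) — the binder `a : RealScalar F`. [folklore] -/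
theorem nonempty_realScalar (F : HodgeCM.CMField) : Nonempty (HodgeCM.Model.LiuIndex.RealScalar F) :=
  ⟨⟨1, map_one _, one_ne_zero⟩⟩

set_option linter.dupNamespace false in
/-- **The complete ∀-telescope of `Hyp411` after `hDel` — and the common binder prefix of `HypLiu418` ∕ `Hyp413` ∕ `HypD3` ∕ `HypD1pp` — is
INHABITED at a GALOIS datum**: `F = ℚ(ζ₇)` (Galois, degree `6`), `ι₁` the embedding of an infinite place, `V` by Landherr
(★ `HodgeCM.landherr_exists_proof`), `a := 1`, `Φ :=` the standard CM type (so `ι₁ ∈ Φ`), and a conjugate-symplectic weight-one character `ν`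
(★ `Liu2021.LemD1IndexedNonVacuityNonsplitPlace.exists_isConjugateSymplectic_hasWeight_one`).  Hypothesis-free; so none of these ∀-statements
is vacuously true for want of a datum.
[cite: Liu2021, Def. 4.1 (l. 1900–1902) and Def. 4.3] -/
theorem exists_galois_binder_prefix :
    ∃ (F : HodgeCM.CMField) (_ : IsGalois ℚ F) (_ : 6 ≤ Module.finrank ℚ F) (ι₁ : F →+* ℂ) (_ : HodgeCM.HermSpace3 F ι₁)
      (_ : HodgeCM.Model.LiuIndex.RealScalar F) (Φ : CMType F) (_ : ι₁ ∈ Φ.1) (ν : Literature.NumberTheory.Automorphic.IdeleClassGroup (F : Type) →ₜ* Circle),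
      IsConjugateSymplectic (F : Type) ν ∧ HasWeight (F : Type) ν 1 := by
  obtain ⟨w⟩ := (inferInstance : Nonempty (InfinitePlace HodgeCM.cyclo7))
  obtain ⟨V⟩ := nonempty_hermSpace3_cyclo7 w.embedding
  obtain ⟨a⟩ := nonempty_realScalar HodgeCM.cyclo7
  obtain ⟨ν, hν, hw⟩ :=
    Literature.NumberTheory.Automorphic.Liu2021.LemD1IndexedNonVacuityNonsplitPlace.exists_isConjugateSymplectic_hasWeight_one
      (HodgeCM.cyclo7 : Type)
  exact ⟨HodgeCM.cyclo7, HodgeCM.cyclo7_isGalois, six_le_finrank_cyclo7, w.embedding, V, a, HodgeCM.stdCMType HodgeCM.cyclo7,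
    embedding_mem_stdCMType HodgeCM.cyclo7 w, ν, hν, hw⟩

set_option linter.dupNamespace false in
/-- **At the Galois datum the complex record system below Liu's threshold `K_f(3)` is inhabited**: for `F = ℚ(ζ₇)`, `ι₁`, and Landherr's `V`,
read through the one-token HodgeCM→CorCM bridge `⟨V.Hm, V.isHermitian, V.signature_ι₁, V.posDef_of_ne⟩ : CorCM.HermSpace3 ⟨F.K⟩ ι₁` (the
spelling of the binder texts of `HypLiu418` ∕ `Hyp413`), ★ `CorCM.HComp.nonempty_complexRecordSystem_K3` (`4 ≤ 6`) inhabits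
`UnitaryCanonicalModel.ComplexRecordSystem` — the carrier of the canonical-model record the rows are read against.  Hypothesis-free.
[cite: Deligne1979ShimuraVarieties, 2.1.2–2.1.4 (PDF p. 24 of Milne's translation)] [cite: Liu2021, App. C l. 4599 and Prop. C.5 l. 4627–4628] -/
theorem exists_galois_complexRecordSystem :
    ∃ (F : HodgeCM.CMField) (_ : IsGalois ℚ F) (_ : 6 ≤ Module.finrank ℚ F) (ι₁ : F →+* ℂ) (V : HodgeCM.HermSpace3 F ι₁),
      Nonempty (Literature.AlgebraicGeometry.ShimuraVarieties.UnitaryCanonicalModel.ComplexRecordSystem (HodgeCM.CMField.K F)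
        (HodgeCM.HermSpace3.Hm V) ι₁
        (Summit.HodgeConjecture.CorCM.Model.frameOf
          (⟨HodgeCM.HermSpace3.Hm V, HodgeCM.HermSpace3.isHermitian V, HodgeCM.HermSpace3.signature_ι₁ V, HodgeCM.HermSpace3.posDef_of_ne V⟩ :
            Summit.HodgeConjecture.CorCM.HermSpace3 ⟨HodgeCM.CMField.K F⟩ ι₁))
        (Summit.HodgeConjecture.CorCM.Model.formCongr_frameOf
          (⟨HodgeCM.HermSpace3.Hm V, HodgeCM.HermSpace3.isHermitian V, HodgeCM.HermSpace3.signature_ι₁ V, HodgeCM.HermSpace3.posDef_of_ne V⟩ :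
            Summit.HodgeConjecture.CorCM.HermSpace3 ⟨HodgeCM.CMField.K F⟩ ι₁))
        (Summit.HodgeConjecture.CorCM.HComp.K3
          (⟨HodgeCM.HermSpace3.Hm V, HodgeCM.HermSpace3.isHermitian V, HodgeCM.HermSpace3.signature_ι₁ V, HodgeCM.HermSpace3.posDef_of_ne V⟩ :
            Summit.HodgeConjecture.CorCM.HermSpace3 ⟨HodgeCM.CMField.K F⟩ ι₁))) := by
  obtain ⟨w⟩ := (inferInstance : Nonempty (InfinitePlace HodgeCM.cyclo7))
  obtain ⟨V⟩ := nonempty_hermSpace3_cyclo7 w.embedding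
  exact ⟨HodgeCM.cyclo7, HodgeCM.cyclo7_isGalois, six_le_finrank_cyclo7, w.embedding, V,
    Summit.HodgeConjecture.CorCM.HComp.nonempty_complexRecordSystem_K3
      (⟨V.Hm, V.isHermitian, V.signature_ι₁, V.posDef_of_ne⟩ : Summit.HodgeConjecture.CorCM.HermSpace3 ⟨HodgeCM.CMField.K HodgeCM.cyclo7⟩ _)
      (le_trans (by norm_num) six_le_finrank_cyclo7)⟩

end Summit.HodgeConjecture.HodgeConjecture.Theorems.HCCMNonvacuityGaloisDatumCyc7

end
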